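import Literature.Geometry.Kaehler.ComplexTorusHodgeRiemann
import Literature.Geometry.Kaehler.ComplexTorusSubtorusDegree
import Literature.Geometry.Kaehler.ComplexTorusSubtorusNonTransverseProduct
import Literature.Geometry.Kaehler.ComplexTorusSubtorusFrameOfSubspace
import Literature.Geometry.Kaehler.ComplexTorusSelfIntersection
import Literature.Geometry.Kaehler.ComplexTorusTypeOfPolarization
import Literature.Geometry.Kaehler.ComplexTorusIntegralFormsBasis
import Literature.Geometry.Kaehler.ComplexTorusIntersectionNumbers
import Literature.Geometry.Kaehler.ComplexTorusIntegralHodgeClasses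
import Literature.Geometry.Kaehler.ComplexTorusSurfaceEllipticCurves
import Literature.Geometry.Kaehler.SymplecticInvariantForms
import Literature.NumberTheory.Transcendental.FormsAlgebraWedgeCommProofs
import HarnessLib

/-!
# Kani's refined Humbert invariant `q_{(A,θ)}(D) = (D·θ)² − 2(D·D)` of a principally polarised abelian
# surface: well defined and POSITIVE DEFINITE on `NS(A,θ) = NS(A)/ℤθ`; `q([E]) = (E·θ)²` for elliptic curves

Layer `Literature/Geometry/Kaehler`, namespace `Literature.Geometry.Kaehler.ComplexTorus`; lane `lit-hodgefound`
(Track 2 foundations library, Layer A4 "cycle classes / Hodge classes / NS"), seat `lit-hodgefound-skel-4`, row A4-62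
FILE 1. Junction of the tree's Hodge index theorem for surfaces in its two-class form
(`ComplexTorusHodgeRiemann`: `IsRiemannForm.hodgeIndex_surface`, `b·v ≤ a²` with equality iff `α ∈ ℝη`), of
Riemann–Roch for a principal polarisation (`ComplexTorusSelfIntersection`: `∫_X E₀^{∧2} = 2`), of the integrality of
intersection numbers (`ComplexTorusIntersectionNumbers`, `ComplexTorusIntegralFormsBasis`) and of the class /
degree of an elliptic curve (`SubtorusFrame.ofSubspace`, `ComplexTorusSubtorusDegree`), all consumed BY NAME.

## Sources followed, verbatim

* E. Kani, *Curves of genus 2 on abelian surfaces* (Queen's preprint; open copy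
  `https://mast.queensu.ca/~kani/papers/CurvesAS2.pdf`, held `paper:galaxy-pdf-7858033051244592000`, chunk p0005),
  §2 "The refined Humbert invariant": "Let `A/K` be an abelian surface, and let `q_A : NS(A) → ℤ` be the integral
  quadratic form on `NS(A)` defined by (one-half of) the self-intersection pairing […] (10) `β_A(D, D′) := q_A(D + D′)
  − q_A(D) − q_A(D′) = (D.D′)`. […] If `θ ∈ 𝒫(A)`, then put
  (11) `q̃_{(A,θ)}(D) = β_A(D, θ)² − 4q_A(D) = (D.θ)² − 2(D.D)`, for `D ∈ NS(A)`.
  It is easy to see (see [K1]) that this defines a positive-definite quadratic form `q_{(A,θ)}` on the quotient space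
  `NS(A, θ) := NS(A)/ℤθ`, so we have that `q̃_{(A,θ)} = q_{(A,θ)} ∘ π_θ` […] The quadratic form `q_{(A,θ)}` or, more
  correctly, the quadratic module `(NS(A, θ), q_{(A,θ)})` is called the *refined Humbert invariant* of the
  principally polarized abelian surface `(A, θ)`; cf. [K4]."; chunk p0007–p0008, **Lemma 12**: "put
  `ℤθ^⊥ := {D ∈ NS(A) : β_A(D, θ) = 0}` […] the restriction `π′_θ` of `π_θ` to `ℤθ^⊥` induces an isomorphism of
  quadratic modules (15) `π′_θ : (ℤθ^⊥, (−4q_A)|) ⥲ (NS(A,θ)^{(2)}, (q_θ)|)`", proof: "(Note that `ℤθ ∩ ℤθ^⊥ = 0`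
  because `q_A` is positive definite on `ℤθ` and negative definite on `ℤθ^⊥` by the Hodge index theorem.)" and
  "`q̃_θ(D) = β_A(D,θ)² − 4q_A(D) ≡ β_A(D,θ)² (mod 2)`"; chunk p0007 (proof of Cor. 11): "since `θ ∈ 𝒫(A)` is a
  primitive element in `NS(A)`". Here [K1] = E. Kani, *Elliptic curves on abelian surfaces*, Manuscripta Math. 84
  (1994) 199–223 (paywalled; WANTED acq-10154), [K4] = Collect. Math. 67 (2016) 21–54.
* H. Kır, *The classification of the refined Humbert invariant for curves of genus 2*, Int. J. Number Theory (2025),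
  arXiv:2211.04396 (held `paper:arxiv-2211.04396`, chunk p0007 L6–L11): "`q_{(A,θ)}(D) = (D.θ)² − 2(D.D)`, for
  `D ∈ NS(A)` […] By [kani1994elliptic], `q_{(A,θ)}` defines a positive definite quadratic form on the quotient group
  `NS(A,θ) := NS(A)/ℤθ`."
* R. Auffarth, *Elliptic curves on abelian varieties*, Illinois J. Math. 59 (2015), arXiv:1507.08617 (held
  `paper:arxiv-1507.08617`), §1 p0003: "`q_r(α) := −(1/((r−1)(Θⁿ)))((α^♮)ʳ·Θ^{n−r})` […] For `n = 2`, we get precisely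
  the quadratic form that Kani introduces in his paper [Kani]"; §3 Remark 3.2 (p0007 L27): "if `α ∈ NS(A)` satisfies
  `α² = 0` in `𝔄^*(A)`, then `q_r(α) = (−1)ʳ(deg α)ʳ` for all `r`"; Remark 3.3 (p0007 L35): "the forms `q_r` descend to
  forms on `NS(A)/ℤ[Θ]`".

## Dictionary (TORUS level, invariant forms) and what is proved

`X = E/Φ(ℤ^ι)` is a complex torus of dimension `2` (`e : Fin (2·2) ≃ ι`); `NS(X)` = the real `2`-forms `η` with
`IsNSForm Φ η` (type `(1,1)`, integral on `Λ`; row A4-13), with class `c₁ = ±η_ℂ` (`ofRealForm`; the sign convention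
`c₁(L(H,χ)) = −Im H` of row A4-16 is immaterial here, every quantity below being QUADRATIC or a product of two
classes); intersection numbers are `∫_X = torusIntegral Φ e` of wedges (row A4-30: `(L₁·L₂) := ∫_X c₁(L₁) ∧ c₁(L₂)`);
a principal polarisation `θ` is `η₀` with `IsPrincipalPolarization Φ η₀` (`(θ²) = ∫_X η₀_ℂ ∧ η₀_ℂ = 2`,
`IsPrincipalPolarization.re_torusIntegral_wedge_self_eq_two`). The **refined Humbert form** is the real number

  `refinedHumbert Φ e η₀ η := (∫_X η_ℂ ∧ η₀_ℂ)² − 2·∫_X η_ℂ ∧ η_ℂ = (D·θ)² − 2(D·D)`   (ONE definition with body),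

read on real parts (both integrals are real on real classes).

* §1 `q` is a quadratic form: `refinedHumbert_smul` (`q(cD) = c²q(D)`), `refinedHumbert_neg`; for `(θ²) = 2`:
  `refinedHumbert_self` (`q(θ) = 0`), **`refinedHumbert_add_smul`** (`q(D + mθ) = q(D)` for every real `m`: `q̃`
  DESCENDS to `NS(A)/ℤθ`, "`q̃_{(A,θ)} = q_{(A,θ)} ∘ π_θ`"), `refinedHumbert_eq_neg_two_mul_of_orthogonal` (Lemma 12
  (15): `q̃(D′) = −2(D′·D′) = −4q_A(D′)` on `θ^⊥`), `refinedHumbert_eq_neg_two_mul_sub` (the reduction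
  `q(D) = −2 (D′·D′)` with `D′ = D − ((D·θ)/2)θ ⟂ θ`).
* §2 **POSITIVE DEFINITENESS (Kani 1994, via the Hodge index theorem)**: for a Riemann form `η₀` with `(θ²) = 2` and
  every real `(1,1)`-form `η`: `IsRiemannForm.refinedHumbert_nonneg` (`q(D) ≥ 0`),
  **`IsRiemannForm.refinedHumbert_eq_zero_iff`** (`q(D) = 0 ↔ D ∈ ℝθ`), `IsRiemannForm.refinedHumbert_pos`
  (`q(D) > 0` off `ℝθ`) — the tree's `IsRiemannForm.hodgeIndex_surface` (`(D·D)(θ·θ) ≤ (D·θ)²`, equality iff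
  `D ∈ ℝθ`) IS the statement.
* §3 principal polarisations: `IsPrincipalPolarization.torusIntegral_wedge_self_eq_two` (`(θ²) = 2`, Riemann–Roch),
  and the NS-level theorem **`IsPrincipalPolarization.refinedHumbert_eq_zero_iff_exists_int`**: for `D ∈ NS(X)`,
  `q(D) = 0 ↔ D ∈ ℤθ` ("`θ` is a primitive element in `NS(A)`": a real multiple `tθ` lying in `NS(X)` has `t ∈ ℤ`,
  `IsPrincipalPolarization.exists_int_of_smul_isNSForm`), `…refinedHumbert_pos_of_forall_ne` — i.e. `q_{(A,θ)}` is a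
  POSITIVE DEFINITE form on `NS(A,θ) = NS(A)/ℤθ`.
* §4 integrality and parity on `NS(X)`: `IsNSForm.exists_int_re_torusIntegral_wedge` (`(D·D′) ∈ ℤ`),
  **`IsNSForm.exists_int_refinedHumbert`** (`q(D) ∈ ℤ`), `IsNSForm.refinedHumbert_int_emod_two`
  (`q(D) ≡ (D·θ) (mod 2)`, Lemma 12 (14)).
* §5 **elliptic curves (Auffarth Remark 3.2 for `n = 2` / Kani)**: for an elliptic curve `E = π(ΦW) ⊂ X` (rank-`2`
  complex lattice subspace `W`, class `[E] = (SubtorusFrame.ofSubspace …).cycleForm e`, `[E] ∧ [E] = 0`):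
  **`refinedHumbert_eq_degree_sq_of_eq_cycleForm`** (`q([E]) = (E·θ)²` with `(E·θ) = ∫_X c₁(θ) ∧ [E] = deg_θ E`),
  `exists_isNSForm_eq_cycleForm_refinedHumbert_eq` (`[E] ∈ NS(X)` by the integral Lefschetz `(1,1)` theorem of row
  A4-23, `q([E]) = (deg_θ E)²` and `deg_θ E > 0`: `q` REPRESENTS the square `(E·θ)²`).

Not here (successor files of the row): Kani's theorem that `(A,θ)` lies on the Humbert surface `H_Δ` iff `q_{(A,θ)}`
represents `Δ` (the Siegel-family junction `q_{θ_Z}(γ) = Δ(q(γ))` with rows A4-59/A4-60, FILE 2), and the converse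
"`q` primitively represents `d²` ⇒ an elliptic curve of degree `d`" (Auffarth Thm. 1.2 for `n = 2`).

## References

* [Kani1994EllipticCurvesAbelianSurfaces] E. Kani, *Elliptic curves on abelian surfaces*, Manuscripta Math. 84 (1994)
  199–223 (the refined Humbert invariant, its positive definiteness).
* [KaniCurvesGenus2AbelianSurfaces] E. Kani, *Curves of genus 2 on abelian surfaces*, preprint, Queen's University,
  `https://mast.queensu.ca/~kani/papers/CurvesAS2.pdf`, §2 (10), (11), Lemma 12 (13)–(15).
* [Kani2016ModuliJacobiansProductElliptic] E. Kani, *The moduli spaces of Jacobians isomorphic to a product of two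
  elliptic curves*, Collect. Math. 67 (2016) 21–54 (cite-only: `q_{(A,θ)}` "as in [K4]").
* [Kir2025RefinedHumbertClassification] H. Kır, *The classification of the refined Humbert invariant for curves of
  genus 2*, Int. J. Number Theory (2025), arXiv:2211.04396, §3.
* [Auffarth2015EllipticCurvesAbelianVarieties] R. Auffarth, *Elliptic curves on abelian varieties*, Illinois J. Math.
  59 (2015) 271–279, arXiv:1507.08617, §1, §3 Remarks 3.2–3.3.
* [Lange2023AbelianVarietiesComplex] H. Lange, *Abelian Varieties over the Complex Numbers* (2023), §2.2.1 (intersection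
  numbers), §1.7.2 Thm. 1.7.3 (Riemann–Roch), §5.1.2 (Hodge index), §2.1.1 (principal = type `(1, …, 1)`).
* [Hartshorne1977] R. Hartshorne, *Algebraic Geometry*, Ch. V Thm. 1.9 (Hodge index theorem for surfaces).
-/

noncomputable section

set_option maxSynthPendingDepth 3

open scoped ComplexOrder
open Module Function Complex

namespace Literature.Geometry.Kaehler

namespace ComplexTorus

/-! ## §0 Algebra of `2`-forms: commutation, the unit power, real parts -/

section Algebra

variable {E : Type*} [NormedAddCommGroup E] [NormedSpace ℂ E]

/-- Two `2`-forms commute on the nose: `β ∧ α = α ∧ β` (graded commutativity, `(-1)^{2·2} = 1`). [cite: WarnerGTM94, 2.6] -/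
theorem wedge_comm_two_two_complex (α β : E [⋀^Fin 2]→L[ℝ] ℂ) : β.wedge α = α.wedge β := by
  rw [ContinuousAlternatingMap.WedgeComm_holds ℝ E ℂ α β, finCongr_refl, ContinuousAlternatingMap.domDomCongr_refl]
  norm_num

/-- `θ^{∧1} = θ`. [cite: Lange2023AbelianVarietiesComplex, §7.3.1] -/
theorem wedgePow_one_eq_self (θ : E [⋀^Fin 2]→L[ℝ] ℂ) : wedgePow θ 1 = θ := by
  rw [wedgePow_one, Literature.Analysis.Complex.oneForm₀, ContinuousAlternatingMap.constOfIsEmpty_one_wedge]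
  ext v
  rfl

/-- `α ∧ (-β) = -(α ∧ β)`. [cite: WarnerGTM94, 2.6] -/
private theorem wedge_neg_right₀ {k l : ℕ} (α : E [⋀^Fin k]→L[ℝ] ℂ) (β : E [⋀^Fin l]→L[ℝ] ℂ) :
    α.wedge (-β) = -(α.wedge β) := by
  rw [eq_neg_iff_add_eq_zero, ← ContinuousAlternatingMap.wedge_add_right, neg_add_cancel,
    ContinuousAlternatingMap.wedge_zero]

/-- `(-α) ∧ β = -(α ∧ β)`. [cite: WarnerGTM94, 2.6] -/
private theorem wedge_neg_left₀ {k l : ℕ} (α : E [⋀^Fin k]→L[ℝ] ℂ) (β : E [⋀^Fin l]→L[ℝ] ℂ) :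
    (-α).wedge β = -(α.wedge β) := by
  rw [eq_neg_iff_add_eq_zero, ← ContinuousAlternatingMap.wedge_add_left, neg_add_cancel,
    ContinuousAlternatingMap.zero_wedge]

variable {ι : Type*} [DecidableEq ι] (Φ : (ι → ℝ) ≃L[ℝ] E) {N : ℕ}

/-- `∫_X (-θ) = -∫_X θ`. [cite: Lange2023AbelianVarietiesComplex, §6.2.4 (p. 310)] -/
private theorem torusIntegral_neg₀ (e : Fin N ≃ ι) (θ : E [⋀^Fin N]→L[ℝ] ℂ) :
    torusIntegral Φ e (-θ) = -torusIntegral Φ e θ := by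
  rw [← neg_one_smul ℂ θ, torusIntegral_smul, neg_one_mul]

/-- `∫_X α ∧ β` is real for real `α`, `β` (`2`-forms on a surface). [cite: Lange2023AbelianVarietiesComplex, §2.2.1 (p. 89)] -/
theorem torusIntegral_wedge_ofRealForm_eq_re (e : Fin (2 * 2) ≃ ι) (α β : E [⋀^Fin 2]→L[ℝ] ℝ) :
    torusIntegral Φ e ((ofRealForm α).wedge (ofRealForm β)) =
      ((torusIntegral Φ e ((ofRealForm α).wedge (ofRealForm β))).re : ℂ) := by
  obtain ⟨a, ha⟩ := exists_torusIntegral_eq_ofReal Φ e (θ := (ofRealForm α).wedge (ofRealForm β))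
    (by rw [Literature.LinearAlgebra.Alternating.conj_wedge, conjForm_ofRealForm, conjForm_ofRealForm])
  rw [ha, Complex.ofReal_re]

/-- `∫_X α ∧ β = ∫_X β ∧ α` for `2`-forms, on real parts. [cite: Lange2023AbelianVarietiesComplex, §2.2.1 (p. 89)] -/
theorem re_torusIntegral_wedge_comm (e : Fin (2 * 2) ≃ ι) (α β : E [⋀^Fin 2]→L[ℝ] ℝ) :
    (torusIntegral Φ e ((ofRealForm α).wedge (ofRealForm β))).re =
      (torusIntegral Φ e ((ofRealForm β).wedge (ofRealForm α))).re := by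
  rw [wedge_comm_two_two_complex]

/-- Additivity of `(D·D′)` in `D`. [cite: Lange2023AbelianVarietiesComplex, §2.2.1 (p. 89)] -/
theorem re_torusIntegral_wedge_add_left (e : Fin (2 * 2) ≃ ι) (α α' β : E [⋀^Fin 2]→L[ℝ] ℝ) :
    (torusIntegral Φ e ((ofRealForm (α + α')).wedge (ofRealForm β))).re =
      (torusIntegral Φ e ((ofRealForm α).wedge (ofRealForm β))).re +
        (torusIntegral Φ e ((ofRealForm α').wedge (ofRealForm β))).re := by
  rw [ofRealForm_add, ContinuousAlternatingMap.wedge_add_left, torusIntegral_add, Complex.add_re]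

/-- Homogeneity of `(D·D′)` in `D`. [cite: Lange2023AbelianVarietiesComplex, §2.2.1 (p. 89)] -/
theorem re_torusIntegral_wedge_smul_left (e : Fin (2 * 2) ≃ ι) (c : ℝ) (α β : E [⋀^Fin 2]→L[ℝ] ℝ) :
    (torusIntegral Φ e ((ofRealForm (c • α)).wedge (ofRealForm β))).re =
      c * (torusIntegral Φ e ((ofRealForm α).wedge (ofRealForm β))).re := by
  rw [ofRealForm_smul, Literature.LinearAlgebra.Alternating.wedge_smul_left_complex, torusIntegral_smul,
    Complex.re_ofReal_mul]

/-- Additivity of `(D·D′)` in `D′`. [cite: Lange2023AbelianVarietiesComplex, §2.2.1 (p. 89)] -/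
theorem re_torusIntegral_wedge_add_right (e : Fin (2 * 2) ≃ ι) (α β β' : E [⋀^Fin 2]→L[ℝ] ℝ) :
    (torusIntegral Φ e ((ofRealForm α).wedge (ofRealForm (β + β')))).re =
      (torusIntegral Φ e ((ofRealForm α).wedge (ofRealForm β))).re +
        (torusIntegral Φ e ((ofRealForm α).wedge (ofRealForm β'))).re := by
  rw [ofRealForm_add, ContinuousAlternatingMap.wedge_add_right, torusIntegral_add, Complex.add_re]

/-- Homogeneity of `(D·D′)` in `D′`. [cite: Lange2023AbelianVarietiesComplex, §2.2.1 (p. 89)] -/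
theorem re_torusIntegral_wedge_smul_right (e : Fin (2 * 2) ≃ ι) (c : ℝ) (α β : E [⋀^Fin 2]→L[ℝ] ℝ) :
    (torusIntegral Φ e ((ofRealForm α).wedge (ofRealForm (c • β)))).re =
      c * (torusIntegral Φ e ((ofRealForm α).wedge (ofRealForm β))).re := by
  rw [ofRealForm_smul, Literature.LinearAlgebra.Alternating.wedge_smul_right_complex, torusIntegral_smul,
    Complex.re_ofReal_mul]

/-- `((-D)·D′) = -(D·D′)`. [cite: Lange2023AbelianVarietiesComplex, §2.2.1 (p. 89)] -/
theorem re_torusIntegral_wedge_neg_left (e : Fin (2 * 2) ≃ ι) (α β : E [⋀^Fin 2]→L[ℝ] ℝ) :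
    (torusIntegral Φ e ((ofRealForm (-α)).wedge (ofRealForm β))).re =
      -(torusIntegral Φ e ((ofRealForm α).wedge (ofRealForm β))).re := by
  rw [ofRealForm_neg, wedge_neg_left₀, torusIntegral_neg₀, Complex.neg_re]

/-- `(D·(-D′)) = -(D·D′)`. [cite: Lange2023AbelianVarietiesComplex, §2.2.1 (p. 89)] -/
theorem re_torusIntegral_wedge_neg_right (e : Fin (2 * 2) ≃ ι) (α β : E [⋀^Fin 2]→L[ℝ] ℝ) :
    (torusIntegral Φ e ((ofRealForm α).wedge (ofRealForm (-β)))).re =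
      -(torusIntegral Φ e ((ofRealForm α).wedge (ofRealForm β))).re := by
  rw [ofRealForm_neg, wedge_neg_right₀, torusIntegral_neg₀, Complex.neg_re]

end Algebra

/-! ## §1 The refined Humbert form `q̃_{(A,θ)}(D) = (D·θ)² − 2(D·D)` -/

section Definition

variable {ι : Type*} [DecidableEq ι] {E : Type*} [NormedAddCommGroup E] [NormedSpace ℂ E]
  (Φ : (ι → ℝ) ≃L[ℝ] E) (e : Fin (2 * 2) ≃ ι)

/-- **Kani's refined Humbert form `q̃_{(A,θ)}(D) = (D·θ)² − 2(D·D)` of a (principally) polarised complex torus of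
dimension `2`** ("(11) `q̃_{(A,θ)}(D) = β_A(D, θ)² − 4q_A(D) = (D.θ)² − 2(D.D)`, for `D ∈ NS(A)`"), at torus level:
`X = E/Φ(ℤ^ι)` with `e : Fin 4 ≃ ι`, the polarisation class `θ` read as a real `2`-form `η₀`, the divisor class `D`
as a real `2`-form `η`, and the intersection numbers as `∫_X` of wedges of the complexified forms
(`(D·θ) = Re ∫_X η_ℂ ∧ η₀_ℂ`, `(D·D) = Re ∫_X η_ℂ ∧ η_ℂ`; the integrals are real, `torusIntegral_wedge_ofRealForm_eq_re`).
For a principal polarisation this form descends to the positive definite form `q_{(A,θ)}` on `NS(A,θ) = NS(A)/ℤθ`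
(`refinedHumbert_add_smul`, `IsPrincipalPolarization.refinedHumbert_eq_zero_iff_exists_int`), the **refined Humbert
invariant**. For `n = 2` it is Auffarth's `q₂`. [cite: KaniCurvesGenus2AbelianSurfaces, §2 (11) (chunk p0005)] [cite: Kani1994EllipticCurvesAbelianSurfaces] [cite: Auffarth2015EllipticCurvesAbelianVarieties, §1 (p0003: "For n = 2, we get precisely the quadratic form that Kani introduces")] -/
def refinedHumbert (η₀ η : E [⋀^Fin 2]→L[ℝ] ℝ) : ℝ :=
  (torusIntegral Φ e ((ofRealForm η).wedge (ofRealForm η₀))).re ^ 2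
    - 2 * (torusIntegral Φ e ((ofRealForm η).wedge (ofRealForm η))).re

/-- Unfolding of `refinedHumbert`. [cite: KaniCurvesGenus2AbelianSurfaces, §2 (11) (chunk p0005)] -/
theorem refinedHumbert_eq (η₀ η : E [⋀^Fin 2]→L[ℝ] ℝ) :
    refinedHumbert Φ e η₀ η =
      (torusIntegral Φ e ((ofRealForm η).wedge (ofRealForm η₀))).re ^ 2
        - 2 * (torusIntegral Φ e ((ofRealForm η).wedge (ofRealForm η))).re := rfl

/-- **`q̃` is quadratic: `q̃(cD) = c² q̃(D)`.** [cite: KaniCurvesGenus2AbelianSurfaces, §2 (11) ("defines a … quadratic form")] -/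
theorem refinedHumbert_smul (η₀ η : E [⋀^Fin 2]→L[ℝ] ℝ) (c : ℝ) :
    refinedHumbert Φ e η₀ (c • η) = c ^ 2 * refinedHumbert Φ e η₀ η := by
  rw [refinedHumbert_eq, refinedHumbert_eq, re_torusIntegral_wedge_smul_left, re_torusIntegral_wedge_smul_left,
    re_torusIntegral_wedge_smul_right]
  ring

/-- `q̃(-D) = q̃(D)`. [cite: KaniCurvesGenus2AbelianSurfaces, §2 (11)] -/
theorem refinedHumbert_neg (η₀ η : E [⋀^Fin 2]→L[ℝ] ℝ) :
    refinedHumbert Φ e η₀ (-η) = refinedHumbert Φ e η₀ η := by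
  rw [← neg_one_smul ℝ η, refinedHumbert_smul]
  norm_num

/-- `q̃(0) = 0`. [cite: KaniCurvesGenus2AbelianSurfaces, §2 (11)] -/
@[simp] theorem refinedHumbert_zero (η₀ : E [⋀^Fin 2]→L[ℝ] ℝ) : refinedHumbert Φ e η₀ 0 = 0 := by
  rw [← zero_smul ℝ (0 : E [⋀^Fin 2]→L[ℝ] ℝ), refinedHumbert_smul]
  ring

/-- **`q̃(θ) = 0` when `(θ²) = 2`** (`(θ·θ)² − 2(θ·θ) = 4 − 4`). [cite: KaniCurvesGenus2AbelianSurfaces, §2 (11) and Lemma 12 (proof: "`β_A(θ, θ) = 2q_A(θ) = 2`")] -/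
theorem refinedHumbert_self {η₀ : E [⋀^Fin 2]→L[ℝ] ℝ}
    (h2 : (torusIntegral Φ e ((ofRealForm η₀).wedge (ofRealForm η₀))).re = 2) :
    refinedHumbert Φ e η₀ η₀ = 0 := by
  rw [refinedHumbert_eq, h2]
  norm_num

/-- **`q̃` descends to `NS(A,θ) = NS(A)/ℤθ`: `q̃(D + mθ) = q̃(D)`** for every (real, in particular integer) `m`, as soon
as `(θ²) = 2` ("this defines a … quadratic form `q_{(A,θ)}` on the quotient space `NS(A,θ) := NS(A)/ℤθ`, so we have that
`q̃_{(A,θ)} = q_{(A,θ)} ∘ π_θ`"; Auffarth Remark 3.3: "the forms `q_r` descend to forms on `NS(A)/ℤ[Θ]`").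
[cite: KaniCurvesGenus2AbelianSurfaces, §2 (11) (chunk p0005)] [cite: Auffarth2015EllipticCurvesAbelianVarieties, §3 Remark 3.3 (p0007 L35)] -/
theorem refinedHumbert_add_smul {η₀ : E [⋀^Fin 2]→L[ℝ] ℝ}
    (h2 : (torusIntegral Φ e ((ofRealForm η₀).wedge (ofRealForm η₀))).re = 2) (η : E [⋀^Fin 2]→L[ℝ] ℝ) (m : ℝ) :
    refinedHumbert Φ e η₀ (η + m • η₀) = refinedHumbert Φ e η₀ η := by
  rw [refinedHumbert_eq, refinedHumbert_eq, re_torusIntegral_wedge_add_left, re_torusIntegral_wedge_smul_left, h2,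
    re_torusIntegral_wedge_add_left, re_torusIntegral_wedge_add_right, re_torusIntegral_wedge_add_right,
    re_torusIntegral_wedge_smul_left, re_torusIntegral_wedge_smul_left, re_torusIntegral_wedge_smul_right,
    re_torusIntegral_wedge_smul_right, h2, re_torusIntegral_wedge_comm Φ e η₀ η]
  ring

/-- `q̃(D + mθ) = q̃(D)` for integer `m`. [cite: KaniCurvesGenus2AbelianSurfaces, §2 (11) (chunk p0005)] -/
theorem refinedHumbert_add_zsmul {η₀ : E [⋀^Fin 2]→L[ℝ] ℝ}
    (h2 : (torusIntegral Φ e ((ofRealForm η₀).wedge (ofRealForm η₀))).re = 2) (η : E [⋀^Fin 2]→L[ℝ] ℝ) (m : ℤ) :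
    refinedHumbert Φ e η₀ (η + m • η₀) = refinedHumbert Φ e η₀ η := by
  rw [← refinedHumbert_add_smul Φ e h2 η (m : ℝ), Int.cast_smul_eq_zsmul ℝ]

/-- `q̃(mθ) = 0` for `(θ²) = 2`. [cite: KaniCurvesGenus2AbelianSurfaces, §2 (11) (chunk p0005)] -/
theorem refinedHumbert_smul_self {η₀ : E [⋀^Fin 2]→L[ℝ] ℝ}
    (h2 : (torusIntegral Φ e ((ofRealForm η₀).wedge (ofRealForm η₀))).re = 2) (m : ℝ) :
    refinedHumbert Φ e η₀ (m • η₀) = 0 := by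
  rw [refinedHumbert_smul, refinedHumbert_self Φ e h2, mul_zero]

/-- **Lemma 12 (15): on `θ^⊥` the refined Humbert form is `−2` times the self-intersection**, `q̃(D′) = −2(D′·D′) =
−4q_A(D′)` for `(D′·θ) = 0`. [cite: KaniCurvesGenus2AbelianSurfaces, §2 Lemma 12 (15) (chunks p0007–p0008)] -/
theorem refinedHumbert_eq_neg_two_mul_of_orthogonal {η₀ η : E [⋀^Fin 2]→L[ℝ] ℝ}
    (h : (torusIntegral Φ e ((ofRealForm η).wedge (ofRealForm η₀))).re = 0) :
    refinedHumbert Φ e η₀ η = -2 * (torusIntegral Φ e ((ofRealForm η).wedge (ofRealForm η))).re := by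
  rw [refinedHumbert_eq, h]
  ring

/-- **The reduction to `θ^⊥`** (proof of Lemma 12: "`D′ = D − nθ ∈ ℤθ^⊥`"): with `a = (D·θ)` and `(θ²) = 2`, the class
`D′ := D − (a/2)θ` is `θ`-orthogonal and `q̃(D) = q̃(D′) = −2(D′·D′)`.
[cite: KaniCurvesGenus2AbelianSurfaces, §2 Lemma 12 (proof) (chunk p0008)] -/
theorem refinedHumbert_eq_neg_two_mul_sub {η₀ : E [⋀^Fin 2]→L[ℝ] ℝ}
    (h2 : (torusIntegral Φ e ((ofRealForm η₀).wedge (ofRealForm η₀))).re = 2) (η : E [⋀^Fin 2]→L[ℝ] ℝ) :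
    (torusIntegral Φ e ((ofRealForm (η - ((torusIntegral Φ e ((ofRealForm η).wedge (ofRealForm η₀))).re / 2) • η₀)).wedge
        (ofRealForm η₀))).re = 0 ∧
      refinedHumbert Φ e η₀ η =
        -2 * (torusIntegral Φ e ((ofRealForm (η - ((torusIntegral Φ e ((ofRealForm η).wedge (ofRealForm η₀))).re / 2) • η₀)).wedge
          (ofRealForm (η - ((torusIntegral Φ e ((ofRealForm η).wedge (ofRealForm η₀))).re / 2) • η₀)))).re := by
  set a := (torusIntegral Φ e ((ofRealForm η).wedge (ofRealForm η₀))).re with ha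
  have horth : (torusIntegral Φ e ((ofRealForm (η - (a / 2) • η₀)).wedge (ofRealForm η₀))).re = 0 := by
    rw [sub_eq_add_neg, ← neg_smul, re_torusIntegral_wedge_add_left, re_torusIntegral_wedge_smul_left, h2, ← ha]
    ring
  refine ⟨horth, ?_⟩
  have h := refinedHumbert_add_smul Φ e h2 (η - (a / 2) • η₀) (a / 2)
  rw [sub_add_cancel] at h
  rw [h, refinedHumbert_eq_neg_two_mul_of_orthogonal Φ e horth]

end Definition

/-! ## §2 Positive definiteness on `NS(A)/ℝθ` — the Hodge index theorem -/

section Positivity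

variable {ι : Type*} [Fintype ι] [DecidableEq ι] {E : Type*} [NormedAddCommGroup E] [NormedSpace ℂ E]
  [FiniteDimensional ℂ E] (Φ : (ι → ℝ) ≃L[ℝ] E) (e : Fin (2 * 2) ≃ ι)

/-- **`q̃_{(A,θ)}(D) ≥ 0` for every real `(1,1)`-class `D`** when `θ` is a polarisation with `(θ²) = 2` — the Hodge
index theorem for the surface `X` in its two-class form `(D·D)(θ·θ) ≤ (D·θ)²` (the tree's
`IsRiemannForm.hodgeIndex_surface`; Kani: "`q_A` is positive definite on `ℤθ` and negative definite on `ℤθ^⊥` by the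
Hodge index theorem"). [cite: KaniCurvesGenus2AbelianSurfaces, §2 (11) and Lemma 12 (proof) (chunks p0005, p0008)] [cite: Kani1994EllipticCurvesAbelianSurfaces] [cite: Hartshorne1977, Ch. V Thm. 1.9] -/
theorem IsRiemannForm.refinedHumbert_nonneg {η₀ : E [⋀^Fin 2]→L[ℝ] ℝ} (hη₀ : IsRiemannForm Φ η₀)
    (h2 : (torusIntegral Φ e ((ofRealForm η₀).wedge (ofRealForm η₀))).re = 2) {η : E [⋀^Fin 2]→L[ℝ] ℝ}
    (h11 : ∀ u v : E, η ![I • u, I • v] = η ![u, v]) :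
    0 ≤ refinedHumbert Φ e η₀ η := by
  obtain ⟨a, b, v, ha, hb, hv, -, hle, -⟩ := hη₀.hodgeIndex_surface Φ e h11
  have ha' : (torusIntegral Φ e ((ofRealForm η).wedge (ofRealForm η₀))).re = -a := by
    have h := re_torusIntegral_wedge_neg_right Φ e η η₀
    rw [ha, Complex.ofReal_re] at h
    linarith
  have hb' : (torusIntegral Φ e ((ofRealForm η).wedge (ofRealForm η))).re = b := by rw [hb, Complex.ofReal_re]
  have hv' : v = 2 := by
    have h := re_torusIntegral_wedge_neg_left Φ e η₀ (-η₀)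
    rw [hv, Complex.ofReal_re, re_torusIntegral_wedge_neg_right, h2] at h
    linarith
  rw [refinedHumbert_eq, ha', hb']
  subst hv'
  nlinarith

/-- **`q̃_{(A,θ)}(D) = 0` iff `D ∈ ℝθ`** (real `(1,1)`-classes, `(θ²) = 2`): the equality case of the Hodge index
inequality. Hence `q_{(A,θ)}` is POSITIVE DEFINITE on `H^{1,1}(X,ℝ)/ℝθ`, and on `NS(A,θ) = NS(A)/ℤθ` (§3).
[cite: KaniCurvesGenus2AbelianSurfaces, §2 (11) ("positive-definite quadratic form `q_{(A,θ)}` on … `NS(A)/ℤθ`") (chunk p0005)] [cite: Kani1994EllipticCurvesAbelianSurfaces] [cite: Hartshorne1977, Ch. V Thm. 1.9] -/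
theorem IsRiemannForm.refinedHumbert_eq_zero_iff {η₀ : E [⋀^Fin 2]→L[ℝ] ℝ} (hη₀ : IsRiemannForm Φ η₀)
    (h2 : (torusIntegral Φ e ((ofRealForm η₀).wedge (ofRealForm η₀))).re = 2) {η : E [⋀^Fin 2]→L[ℝ] ℝ}
    (h11 : ∀ u v : E, η ![I • u, I • v] = η ![u, v]) :
    refinedHumbert Φ e η₀ η = 0 ↔ ∃ t : ℝ, η = t • η₀ := by
  obtain ⟨a, b, v, ha, hb, hv, -, -, hiff⟩ := hη₀.hodgeIndex_surface Φ e h11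
  have ha' : (torusIntegral Φ e ((ofRealForm η).wedge (ofRealForm η₀))).re = -a := by
    have h := re_torusIntegral_wedge_neg_right Φ e η η₀
    rw [ha, Complex.ofReal_re] at h
    linarith
  have hb' : (torusIntegral Φ e ((ofRealForm η).wedge (ofRealForm η))).re = b := by rw [hb, Complex.ofReal_re]
  have hv' : v = 2 := by
    have h := re_torusIntegral_wedge_neg_left Φ e η₀ (-η₀)
    rw [hv, Complex.ofReal_re, re_torusIntegral_wedge_neg_right, h2] at h
    linarith
  rw [← hiff, refinedHumbert_eq, ha', hb', hv']
  constructor <;> intro h <;> nlinarith [h]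

/-- **`q̃_{(A,θ)}(D) > 0` off `ℝθ`.** [cite: KaniCurvesGenus2AbelianSurfaces, §2 (11) (chunk p0005)] [cite: Kani1994EllipticCurvesAbelianSurfaces] -/
theorem IsRiemannForm.refinedHumbert_pos {η₀ : E [⋀^Fin 2]→L[ℝ] ℝ} (hη₀ : IsRiemannForm Φ η₀)
    (h2 : (torusIntegral Φ e ((ofRealForm η₀).wedge (ofRealForm η₀))).re = 2) {η : E [⋀^Fin 2]→L[ℝ] ℝ}
    (h11 : ∀ u v : E, η ![I • u, I • v] = η ![u, v]) (hne : ∀ t : ℝ, η ≠ t • η₀) :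
    0 < refinedHumbert Φ e η₀ η := by
  rcases (hη₀.refinedHumbert_nonneg Φ e h2 h11).lt_or_eq with h | h
  · exact h
  · exfalso
    obtain ⟨t, ht⟩ := (hη₀.refinedHumbert_eq_zero_iff Φ e h2 h11).1 h.symm
    exact hne t ht

/-- **`−2(D′·D′) > 0` for `0 ≠ D′ ⟂ θ`** (the negative definiteness of `q_A` on `ℤθ^⊥`, Lemma 12's Hodge-index
remark, here for real `(1,1)`-classes): if `(D′·θ) = 0` and `D′ ≠ 0` then `(D′·D′) < 0`.
[cite: KaniCurvesGenus2AbelianSurfaces, §2 Lemma 12 (proof: "negative definite on `ℤθ^⊥` by the Hodge index theorem") (chunk p0008)] [cite: Hartshorne1977, Ch. V Thm. 1.9] -/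
theorem IsRiemannForm.re_torusIntegral_wedge_self_neg_of_orthogonal {η₀ : E [⋀^Fin 2]→L[ℝ] ℝ}
    (hη₀ : IsRiemannForm Φ η₀) (h2 : (torusIntegral Φ e ((ofRealForm η₀).wedge (ofRealForm η₀))).re = 2)
    {η : E [⋀^Fin 2]→L[ℝ] ℝ} (h11 : ∀ u v : E, η ![I • u, I • v] = η ![u, v])
    (horth : (torusIntegral Φ e ((ofRealForm η).wedge (ofRealForm η₀))).re = 0) (hne : η ≠ 0) :
    (torusIntegral Φ e ((ofRealForm η).wedge (ofRealForm η))).re < 0 := by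
  have hne' : ∀ t : ℝ, η ≠ t • η₀ := by
    intro t ht
    have h := horth
    rw [ht, re_torusIntegral_wedge_smul_left, h2] at h
    have ht0 : t = 0 := by linarith
    rw [ht0, zero_smul] at ht
    exact hne ht
  have hpos := hη₀.refinedHumbert_pos Φ e h2 h11 hne'
  rw [refinedHumbert_eq_neg_two_mul_of_orthogonal Φ e horth] at hpos
  linarith

end Positivity

/-! ## §3 Principal polarisations: `(θ²) = 2`, `θ` primitive in `NS(X)`, positive definiteness on `NS(A)/ℤθ` -/

section Principal

variable {ι : Type*} [Fintype ι] [DecidableEq ι] {E : Type*} [NormedAddCommGroup E] [NormedSpace ℂ E]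
  (Φ : (ι → ℝ) ≃L[ℝ] E) (e : Fin (2 * 2) ≃ ι)

/-- **Riemann–Roch for a principal polarisation of a surface: `(θ²) = ∫_X θ_ℂ ∧ θ_ℂ = 2`** (type `(1,1)`,
`∫_X E^{∧2} = (−1)²·2!·1·1`, row A4-26 `IsRiemannForm.torusIntegral_wedgePow_of_type_one`).
[cite: KaniCurvesGenus2AbelianSurfaces, §2 ("by the Riemann-Roch Theorem … `(Θ.Θ) = 2`" — Kır p0007; "`β_A(θ,θ) = 2q_A(θ) = 2`", chunk p0008)] [cite: Lange2023AbelianVarietiesComplex, §1.7.2 Thm. 1.7.3 and §2.1.1] -/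
theorem IsPrincipalPolarization.torusIntegral_wedge_self_eq_two {η₀ : E [⋀^Fin 2]→L[ℝ] ℝ}
    (hp : IsPrincipalPolarization Φ η₀) :
    torusIntegral Φ e ((ofRealForm η₀).wedge (ofRealForm η₀)) = 2 := by
  obtain ⟨g, d, hd, h1⟩ := hp.exists_type_eq_one
  have hcard := hd.card_eq
  have hcard' : Fintype.card ι = 2 * 2 := by rw [← Fintype.card_congr e, Fintype.card_fin]
  obtain rfl : g = 2 := by omega
  have hd1 : IsPolarizationType Φ η₀ (fun _ : Fin 2 ↦ 1) := by
    have : d = fun _ ↦ 1 := funext h1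
    rwa [this] at hd
  have h := (hp.isRiemannForm.torusIntegral_wedgePow_of_type_one Φ hd1 e).1
  rw [wedgePow_two_eq_wedge_self] at h
  rw [h]
  norm_num [Nat.factorial]

/-- `(θ²) = 2` on real parts. [cite: KaniCurvesGenus2AbelianSurfaces, §2 (chunk p0008)] -/
theorem IsPrincipalPolarization.re_torusIntegral_wedge_self_eq_two {η₀ : E [⋀^Fin 2]→L[ℝ] ℝ}
    (hp : IsPrincipalPolarization Φ η₀) :
    (torusIntegral Φ e ((ofRealForm η₀).wedge (ofRealForm η₀))).re = 2 := by
  rw [hp.torusIntegral_wedge_self_eq_two Φ e]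
  norm_num

include e in
/-- **`θ ∈ 𝒫(A)` is a primitive element of `NS(A)`**: a REAL multiple `tθ` of a principal polarisation that lies in
`NS(X)` has `t ∈ ℤ` (evaluate on a symplectic pair `(λ₁, μ₁)` of a type-`(1,1)` basis: `tθ(λ₁, μ₁) = t`).
[cite: KaniCurvesGenus2AbelianSurfaces, §2 proof of Cor. 11 ("since `θ ∈ 𝒫(A)` is a primitive element in `NS(A)`") (chunk p0007)] [cite: Lange2023AbelianVarietiesComplex, §2.1.1 (principal = type `(1, …, 1)`)] -/
theorem IsPrincipalPolarization.exists_int_of_smul_isNSForm {η₀ : E [⋀^Fin 2]→L[ℝ] ℝ}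
    (hp : IsPrincipalPolarization Φ η₀) {t : ℝ} (ht : IsNSForm Φ (t • η₀)) : ∃ m : ℤ, t = m := by
  obtain ⟨g, d, hd, h1⟩ := hp.exists_type_eq_one
  have hg : 0 < g := by
    have hcard := hd.card_eq
    have hcard' : Fintype.card ι = 2 * 2 := by rw [← Fintype.card_congr e, Fintype.card_fin]
    omega
  obtain ⟨-, b, -, -, huv⟩ := hd
  set i₀ : Fin g := ⟨0, hg⟩
  obtain ⟨m, hm⟩ := ht.integral (b (Sum.inl i₀)) (b (Sum.inr i₀))
  refine ⟨m, ?_⟩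
  have h := huv i₀ i₀
  rw [if_pos rfl, h1 i₀, Nat.cast_one] at h
  rw [ContinuousAlternatingMap.smul_apply, smul_eq_mul] at hm
  have hlv : ∀ n : ι → ℤ, latticeVec Φ n = Φ (intVec n) := fun n ↦ rfl
  rw [hlv, hlv, h, mul_one] at hm
  exact hm

variable [FiniteDimensional ℂ E]

/-- `q̃ ≥ 0` on real `(1,1)`-classes for a principal `θ`. [cite: KaniCurvesGenus2AbelianSurfaces, §2 (11) (chunk p0005)] [cite: Kani1994EllipticCurvesAbelianSurfaces] -/
theorem IsPrincipalPolarization.refinedHumbert_nonneg {η₀ : E [⋀^Fin 2]→L[ℝ] ℝ} (hp : IsPrincipalPolarization Φ η₀)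
    {η : E [⋀^Fin 2]→L[ℝ] ℝ} (h11 : ∀ u v : E, η ![I • u, I • v] = η ![u, v]) : 0 ≤ refinedHumbert Φ e η₀ η :=
  hp.isRiemannForm.refinedHumbert_nonneg Φ e (hp.re_torusIntegral_wedge_self_eq_two Φ e) h11

/-- `q̃(D) = 0 ↔ D ∈ ℝθ` for a principal `θ` and a real `(1,1)`-class `D`. [cite: KaniCurvesGenus2AbelianSurfaces, §2 (11) (chunk p0005)] [cite: Kani1994EllipticCurvesAbelianSurfaces] -/
theorem IsPrincipalPolarization.refinedHumbert_eq_zero_iff {η₀ : E [⋀^Fin 2]→L[ℝ] ℝ}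
    (hp : IsPrincipalPolarization Φ η₀) {η : E [⋀^Fin 2]→L[ℝ] ℝ} (h11 : ∀ u v : E, η ![I • u, I • v] = η ![u, v]) :
    refinedHumbert Φ e η₀ η = 0 ↔ ∃ t : ℝ, η = t • η₀ :=
  hp.isRiemannForm.refinedHumbert_eq_zero_iff Φ e (hp.re_torusIntegral_wedge_self_eq_two Φ e) h11

/-- **KANI: `q_{(A,θ)}` is POSITIVE DEFINITE on `NS(A,θ) = NS(A)/ℤθ`.** For `D ∈ NS(X)` and a principal
polarisation `θ`: `q̃_{(A,θ)}(D) = 0 ↔ D ∈ ℤθ` (and `q̃ ≥ 0`, `q̃(D + mθ) = q̃(D)`): the Hodge index equality case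
`D ∈ ℝθ` together with the primitivity of `θ` in `NS(X)`. [cite: KaniCurvesGenus2AbelianSurfaces, §2 (11) ("defines a positive-definite quadratic form `q_{(A,θ)}` on the quotient space `NS(A,θ) := NS(A)/ℤθ`") (chunk p0005)] [cite: Kani1994EllipticCurvesAbelianSurfaces] [cite: Kir2025RefinedHumbertClassification, §3 (p0007 L9–L11)] -/
theorem IsPrincipalPolarization.refinedHumbert_eq_zero_iff_exists_int {η₀ : E [⋀^Fin 2]→L[ℝ] ℝ}
    (hp : IsPrincipalPolarization Φ η₀) {η : E [⋀^Fin 2]→L[ℝ] ℝ} (hη : IsNSForm Φ η) :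
    refinedHumbert Φ e η₀ η = 0 ↔ ∃ m : ℤ, η = m • η₀ := by
  rw [hp.refinedHumbert_eq_zero_iff Φ e hη.type_one_one]
  constructor
  · rintro ⟨t, rfl⟩
    obtain ⟨m, rfl⟩ := hp.exists_int_of_smul_isNSForm Φ e hη
    exact ⟨m, by rw [Int.cast_smul_eq_zsmul ℝ]⟩
  · rintro ⟨m, rfl⟩
    exact ⟨m, by rw [Int.cast_smul_eq_zsmul ℝ]⟩

/-- **`q_{(A,θ)}(D̄) > 0` for `D̄ ≠ 0` in `NS(A)/ℤθ`.** [cite: KaniCurvesGenus2AbelianSurfaces, §2 (11) (chunk p0005)] [cite: Kani1994EllipticCurvesAbelianSurfaces] -/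
theorem IsPrincipalPolarization.refinedHumbert_pos_of_forall_ne {η₀ : E [⋀^Fin 2]→L[ℝ] ℝ}
    (hp : IsPrincipalPolarization Φ η₀) {η : E [⋀^Fin 2]→L[ℝ] ℝ} (hη : IsNSForm Φ η) (hne : ∀ m : ℤ, η ≠ m • η₀) :
    0 < refinedHumbert Φ e η₀ η := by
  rcases (hp.refinedHumbert_nonneg Φ e hη.type_one_one).lt_or_eq with h | h
  · exact h
  · exfalso
    obtain ⟨m, hm⟩ := (hp.refinedHumbert_eq_zero_iff_exists_int Φ e hη).1 h.symm
    exact hne m hm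

end Principal

/-! ## §4 Integrality and parity on `NS(X)` -/

section Integrality

variable {ι : Type*} [DecidableEq ι] {E : Type*} [NormedAddCommGroup E] [NormedSpace ℂ E]
  (Φ : (ι → ℝ) ≃L[ℝ] E) (e : Fin (2 * 2) ≃ ι)

/-- **`(D·D′) ∈ ℤ` for `D, D′ ∈ NS(X)`** (row A4-30: the intersection number of integral classes is an integer).
[cite: KaniCurvesGenus2AbelianSurfaces, §2 (10) ("`q_A : NS(A) → ℤ` … integral quadratic form") (chunk p0005)] [cite: Lange2023AbelianVarietiesComplex, §2.2.1 (p. 89)] -/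
theorem IsNSForm.exists_int_re_torusIntegral_wedge {η η' : E [⋀^Fin 2]→L[ℝ] ℝ} (hη : IsNSForm Φ η)
    (hη' : IsNSForm Φ η') :
    ∃ z : ℤ, (torusIntegral Φ e ((ofRealForm η).wedge (ofRealForm η'))).re = z := by
  obtain ⟨z, hz⟩ := exists_int_torusIntegral_eq Φ e
    (wedge_mem_integralForms Φ (ofRealForm_mem_integralForms_two Φ hη) (ofRealForm_mem_integralForms_two Φ hη'))
  exact ⟨z, by rw [hz]; norm_num⟩

/-- **`q̃_{(A,θ)}(D) ∈ ℤ` for `D, θ ∈ NS(X)`**: the refined Humbert form is an INTEGRAL quadratic form.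
[cite: KaniCurvesGenus2AbelianSurfaces, §2 (11) ("integral, positive definite quadratic forms in `ρ − 1` variables") (chunk p0005)] -/
theorem IsNSForm.exists_int_refinedHumbert {η₀ η : E [⋀^Fin 2]→L[ℝ] ℝ} (hη₀ : IsNSForm Φ η₀) (hη : IsNSForm Φ η) :
    ∃ z : ℤ, refinedHumbert Φ e η₀ η = z := by
  obtain ⟨a, ha⟩ := hη.exists_int_re_torusIntegral_wedge Φ e hη₀
  obtain ⟨b, hb⟩ := hη.exists_int_re_torusIntegral_wedge Φ e hη
  exact ⟨a ^ 2 - 2 * b, by rw [refinedHumbert_eq, ha, hb]; push_cast; ring⟩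

/-- **Lemma 12 (14), parity: `q̃_{(A,θ)}(D) ≡ (D·θ)² ≡ (D·θ) (mod 2)`** — with `(D·θ) = a ∈ ℤ` and `(D·D) = b ∈ ℤ`,
`a² − 2b ≡ a (mod 2)`. [cite: KaniCurvesGenus2AbelianSurfaces, §2 Lemma 12 (14) and proof ("`q̃_θ(D) = β_A(D,θ)² − 4q_A(D) ≡ β_A(D,θ)² (mod 2)`") (chunks p0007–p0008)] -/
theorem IsNSForm.refinedHumbert_int_emod_two {η₀ η : E [⋀^Fin 2]→L[ℝ] ℝ} (hη : IsNSForm Φ η)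
    {q a : ℤ} (hq : refinedHumbert Φ e η₀ η = q)
    (ha : (torusIntegral Φ e ((ofRealForm η).wedge (ofRealForm η₀))).re = a) : q % 2 = a % 2 := by
  obtain ⟨b, hb⟩ := hη.exists_int_re_torusIntegral_wedge Φ e hη
  have h : (q : ℝ) = a ^ 2 - 2 * b := by rw [← hq, refinedHumbert_eq, ha, hb]
  have h' : q = a ^ 2 - 2 * b := by exact_mod_cast h
  subst h'
  have hsq : a ^ 2 % 2 = a % 2 := by
    rcases Int.emod_two_eq_zero_or_one a with h0 | h0 <;> simp [pow_two, Int.mul_emod, h0]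
  omega

end Integrality

/-! ## §5 Elliptic curves: `q̃_{(A,θ)}([E]) = (E·θ)²` -/

section EllipticCurves

variable {ι : Type*} [Fintype ι] [DecidableEq ι] {E : Type*} [NormedAddCommGroup E] [NormedSpace ℂ E]
  (Φ : (ι → ℝ) ≃L[ℝ] E) (W : Submodule ℝ (ι → ℝ)) (hW : IsLatticeSubspace W) (hWc : IsComplexSubspace Φ W)
  (eY : Fin (2 * 1) ≃ Fin (subRank W)) (hpos : orientationSign (subtorusPeriod Φ W hW hWc) eY = 1)
  (e : Fin (2 * 1 + 2) ≃ ι)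

/-- **Auffarth Remark 3.2 for `n = 2` / Kani: `q̃_{(A,θ)}([E]) = (E·θ)²` for an elliptic curve `E ⊂ X`** — the class
`[E]` of the one-dimensional complex subtorus `E = π(ΦW)` has `[E] ∧ [E] = 0` (p36 `SubtorusFrame.cycleForm_wedge_self_eq_zero`),
so only the square of the degree `(E·θ) = ∫_X c₁(θ) ∧ [E] = deg_θ E` survives; here for ANY real form `η` with
`η_ℂ = [E]` and any `θ = η₀`. [cite: Auffarth2015EllipticCurvesAbelianVarieties, §3 Remark 3.2 (p0007 L27: "if `α² = 0` … `q_r(α) = (−1)ʳ(deg α)ʳ`")] [cite: Kani1994EllipticCurvesAbelianSurfaces] -/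
theorem refinedHumbert_eq_degree_sq_of_eq_cycleForm (η₀ : E [⋀^Fin 2]→L[ℝ] ℝ) {η : E [⋀^Fin 2]→L[ℝ] ℝ}
    (hη : ofRealForm η = (SubtorusFrame.ofSubspace Φ W hW hWc eY hpos).cycleForm e) :
    refinedHumbert Φ e η₀ η =
      (torusIntegral Φ e ((wedgePow (ofRealForm (-η₀)) 1).wedge
        ((SubtorusFrame.ofSubspace Φ W hW hWc eY hpos).cycleForm e))).re ^ 2 := by
  set Z := SubtorusFrame.ofSubspace Φ W hW hWc eY hpos with hZ
  have hsq : (torusIntegral Φ e ((ofRealForm η).wedge (ofRealForm η))).re = 0 := by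
    rw [hη, Z.cycleForm_wedge_self_eq_zero Φ e (by norm_num), torusIntegral_zero, Complex.zero_re]
  have hdeg : (torusIntegral Φ e ((ofRealForm η).wedge (ofRealForm η₀))).re =
      -(torusIntegral Φ e ((wedgePow (ofRealForm (-η₀)) 1).wedge (Z.cycleForm e))).re := by
    rw [wedgePow_one_eq_self, ofRealForm_neg, wedge_neg_left₀, torusIntegral_neg₀, Complex.neg_re, neg_neg, ← hη,
      wedge_comm_two_two_complex]
  rw [refinedHumbert_eq, hsq, hdeg]
  ring

/-- **`q̃_{(A,θ)}` represents `(E·θ)²`**: the class of an elliptic curve `E ⊂ X` lies in `NS(X)` (integral Lefschetz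
`(1,1)`, row A4-23 `mem_integralHodgeClasses_one_iff_exists`), its refined Humbert value is the square of its degree
`deg_θ E = (E·θ)`, and that degree is POSITIVE for a polarisation `θ` (p36 `SubtorusFrame.degree_pos_of_isRiemannForm`). [cite: Auffarth2015EllipticCurvesAbelianVarieties, §3 Remark 3.2 (p0007 L27)] [cite: Kani1994EllipticCurvesAbelianSurfaces] [cite: KaniCurvesGenus2AbelianSurfaces, §2 (11) (chunk p0005)] -/
theorem exists_isNSForm_eq_cycleForm_refinedHumbert_eq {η₀ : E [⋀^Fin 2]→L[ℝ] ℝ} (hη₀ : IsRiemannForm Φ η₀) :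
    ∃ η : E [⋀^Fin 2]→L[ℝ] ℝ, IsNSForm Φ η ∧
      ofRealForm η = (SubtorusFrame.ofSubspace Φ W hW hWc eY hpos).cycleForm e ∧
      refinedHumbert Φ e η₀ η =
        (torusIntegral Φ e ((wedgePow (ofRealForm (-η₀)) 1).wedge
          ((SubtorusFrame.ofSubspace Φ W hW hWc eY hpos).cycleForm e))).re ^ 2 ∧
      0 < (torusIntegral Φ e ((wedgePow (ofRealForm (-η₀)) 1).wedge
          ((SubtorusFrame.ofSubspace Φ W hW hWc eY hpos).cycleForm e))).re := by
  set Z := SubtorusFrame.ofSubspace Φ W hW hWc eY hpos with hZ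
  have hγI : Z.cycleForm e ∈ integralHodgeClasses Φ 1 :=
    (mem_integralHodgeClasses_iff Φ).2
      ⟨Z.cycleForm_mem_integralForms e, ((mem_hodgeClasses_iff Φ).1 (Z.cycleForm_mem_hodgeClasses (p := 1) e)).2⟩
  obtain ⟨η, hηNS, hηγ⟩ := (mem_integralHodgeClasses_one_iff_exists Φ).1 hγI
  have hdeg : 0 < torusIntegral Φ e ((wedgePow (ofRealForm (-η₀)) 1).wedge (Z.cycleForm e)) :=
    Z.degree_pos_of_isRiemannForm Φ W hW hWc (SubtorusFrame.realSpan_ofSubspace Φ W hW hWc eY hpos) e hη₀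
  rw [Complex.lt_def] at hdeg
  refine ⟨η, (mem_neronSeveriGroup_iff Φ).1 hηNS, hηγ,
    refinedHumbert_eq_degree_sq_of_eq_cycleForm Φ W hW hWc eY hpos e η₀ hηγ, by simpa using hdeg.1⟩

end EllipticCurves

/-! ## §6 Kani's Lemma 12: `NS(A)_θ^{(2)} = ℤθ ⊕ ℤθ^⊥` and `π′_θ : (ℤθ^⊥, −4q_A) ⥲ (NS(A,θ)^{(2)}, q_θ)` -/

section LemmaTwelve

variable {ι : Type*} [Fintype ι] [DecidableEq ι] {E : Type*} [NormedAddCommGroup E] [NormedSpace ℂ E]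
  (Φ : (ι → ℝ) ≃L[ℝ] E) (e : Fin (2 * 2) ≃ ι)

/-- `(nθ·θ) = 2n` for a principal `θ` (`(θ²) = 2`). [cite: KaniCurvesGenus2AbelianSurfaces, §2 Lemma 12 (proof: "`β_A(θ,θ) = 2q_A(θ) = 2`") (chunk p0008)] -/
theorem IsPrincipalPolarization.re_torusIntegral_zsmul_wedge_self {η₀ : E [⋀^Fin 2]→L[ℝ] ℝ}
    (hp : IsPrincipalPolarization Φ η₀) (n : ℤ) :
    (torusIntegral Φ e ((ofRealForm (n • η₀)).wedge (ofRealForm η₀))).re = 2 * n := by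
  rw [← Int.cast_smul_eq_zsmul ℝ n, re_torusIntegral_wedge_smul_left, hp.re_torusIntegral_wedge_self_eq_two Φ e]
  ring

/-- **`ℤθ ∩ ℤθ^⊥ = 0`**: `nθ` is `θ`-orthogonal only for `n = 0` (Kani: "because `q_A` is positive definite on `ℤθ`
and negative definite on `ℤθ^⊥` by the Hodge index theorem"; here read off `(nθ·θ) = 2n`).
[cite: KaniCurvesGenus2AbelianSurfaces, §2 Lemma 12 (proof) (chunk p0008)] -/
theorem IsPrincipalPolarization.re_torusIntegral_zsmul_wedge_self_eq_zero_iff {η₀ : E [⋀^Fin 2]→L[ℝ] ℝ}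
    (hp : IsPrincipalPolarization Φ η₀) {n : ℤ} :
    (torusIntegral Φ e ((ofRealForm (n • η₀)).wedge (ofRealForm η₀))).re = 0 ↔ n = 0 := by
  rw [hp.re_torusIntegral_zsmul_wedge_self Φ e n]
  constructor
  · intro h
    exact_mod_cast (by linarith : (n : ℝ) = 0)
  · rintro rfl
    simp

/-- **Lemma 12 (13), `⊆`: `NS(A)_θ^{(2)} ⊆ ℤθ + ℤθ^⊥`.** If `D ∈ NS(X)` has EVEN degree `(D·θ) = a`, then
`D = (a/2)θ + D′` with `D′ ∈ NS(X)` and `(D′·θ) = 0` ("`n := β_A(D,θ)/2 ∈ ℤ`, so `D′ = D − nθ ∈ ℤθ^⊥` and hence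
`D = nθ + D′`"). [cite: KaniCurvesGenus2AbelianSurfaces, §2 Lemma 12 (13) and proof (chunks p0007–p0008)] -/
theorem IsPrincipalPolarization.exists_eq_zsmul_add_orthogonal {η₀ : E [⋀^Fin 2]→L[ℝ] ℝ}
    (hp : IsPrincipalPolarization Φ η₀) {η : E [⋀^Fin 2]→L[ℝ] ℝ} (hη : IsNSForm Φ η) {a : ℤ}
    (ha : (torusIntegral Φ e ((ofRealForm η).wedge (ofRealForm η₀))).re = a) (h2 : 2 ∣ a) :
    ∃ η' : E [⋀^Fin 2]→L[ℝ] ℝ, IsNSForm Φ η' ∧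
      (torusIntegral Φ e ((ofRealForm η').wedge (ofRealForm η₀))).re = 0 ∧ η = (a / 2) • η₀ + η' := by
  refine ⟨η + (-(a / 2)) • η₀, ?_, ?_, ?_⟩
  · rw [← mem_neronSeveriGroup_iff] at hη ⊢
    exact add_mem hη (AddSubgroup.zsmul_mem _ ((mem_neronSeveriGroup_iff Φ).2 hp.isRiemannForm.isNSForm) _)
  · have hdiv : ((a / 2 : ℤ) : ℝ) * 2 = a := by exact_mod_cast Int.ediv_mul_cancel h2
    rw [re_torusIntegral_wedge_add_left, ha, hp.re_torusIntegral_zsmul_wedge_self Φ e, Int.cast_neg]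
    linarith
  · rw [neg_smul]
    abel

/-- **Lemma 12 (13), directness and `π′_θ` injective: `ℤθ + ℤθ^⊥` is a DIRECT sum.** If `nθ + D′ = n′θ + D″` with
`D′, D″` `θ`-orthogonal, then `n = n′` and `D′ = D″` (pair with `θ`: `2n = 2n′`); in particular the restriction `π′_θ`
of `π_θ : NS(A) → NS(A)/ℤθ` to `ℤθ^⊥` is injective ("because `Ker(π_θ) ∩ ℤθ^⊥ = 0`").
[cite: KaniCurvesGenus2AbelianSurfaces, §2 Lemma 12 (13), (15) and proof (chunks p0007–p0008)] -/
theorem IsPrincipalPolarization.eq_of_zsmul_add_eq_zsmul_add {η₀ : E [⋀^Fin 2]→L[ℝ] ℝ}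
    (hp : IsPrincipalPolarization Φ η₀) {n n' : ℤ} {η' η'' : E [⋀^Fin 2]→L[ℝ] ℝ}
    (h' : (torusIntegral Φ e ((ofRealForm η').wedge (ofRealForm η₀))).re = 0)
    (h'' : (torusIntegral Φ e ((ofRealForm η'').wedge (ofRealForm η₀))).re = 0)
    (h : n • η₀ + η' = n' • η₀ + η'') : n = n' ∧ η' = η'' := by
  have hn : n = n' := by
    have h1 := congrArg (fun x ↦ (torusIntegral Φ e ((ofRealForm x).wedge (ofRealForm η₀))).re) h
    simp only at h1
    rw [re_torusIntegral_wedge_add_left, re_torusIntegral_wedge_add_left, hp.re_torusIntegral_zsmul_wedge_self Φ e,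
      hp.re_torusIntegral_zsmul_wedge_self Φ e, h', h''] at h1
    exact_mod_cast (by linarith : (n : ℝ) = n')
  subst hn
  exact ⟨rfl, add_left_cancel h⟩

omit [Fintype ι] in
/-- **Lemma 12 (14): `q_θ(D̄) ≡ 0 (mod 2)` iff `(D·θ) ≡ 0 (mod 2)`** for `D ∈ NS(X)` — `q̃_θ(D) = β_A(D,θ)² − 4q_A(D) ≡
β_A(D,θ)² (mod 2)` (`IsNSForm.refinedHumbert_int_emod_two`); so `NS(A,θ)^{(2)} = π_θ(NS(A)_θ^{(2)})`.
[cite: KaniCurvesGenus2AbelianSurfaces, §2 Lemma 12 (14) and proof (chunks p0007–p0008)] -/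
theorem IsNSForm.two_dvd_refinedHumbert_iff {η₀ η : E [⋀^Fin 2]→L[ℝ] ℝ} (hη : IsNSForm Φ η) {q a : ℤ}
    (hq : refinedHumbert Φ e η₀ η = q) (ha : (torusIntegral Φ e ((ofRealForm η).wedge (ofRealForm η₀))).re = a) :
    2 ∣ q ↔ 2 ∣ a := by
  have h := hη.refinedHumbert_int_emod_two Φ e hq ha
  omega

/-- **Lemma 12 (15): `π′_θ : (ℤθ^⊥, −4q_A) ⥲ (NS(A,θ)^{(2)}, q_θ)` is onto with the stated values.** Every `D ∈ NS(X)`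
with `q̃_θ(D)` EVEN is congruent mod `ℤθ` to a `θ`-orthogonal `D′ ∈ NS(X)` (`D = nθ + D′`, `n = (D·θ)/2`), and
`q̃_θ(D) = q̃_θ(D′) = −2(D′·D′) = −4q_A(D′)` (`q_A(D) = (D·D)/2`). With `eq_of_zsmul_add_eq_zsmul_add` (`π′_θ`
injective) this is the isomorphism of quadratic modules (15). [cite: KaniCurvesGenus2AbelianSurfaces, §2 Lemma 12 (15) and proof ("`q_θ(π′_θ(D)) = −4q_A(D)`") (chunks p0007–p0008)] -/
theorem IsPrincipalPolarization.exists_orthogonal_refinedHumbert_eq_of_two_dvd {η₀ : E [⋀^Fin 2]→L[ℝ] ℝ}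
    (hp : IsPrincipalPolarization Φ η₀) {η : E [⋀^Fin 2]→L[ℝ] ℝ} (hη : IsNSForm Φ η) {q : ℤ}
    (hq : refinedHumbert Φ e η₀ η = q) (h2 : 2 ∣ q) :
    ∃ (n : ℤ) (η' : E [⋀^Fin 2]→L[ℝ] ℝ), IsNSForm Φ η' ∧
      (torusIntegral Φ e ((ofRealForm η').wedge (ofRealForm η₀))).re = 0 ∧ η = n • η₀ + η' ∧
      refinedHumbert Φ e η₀ η = refinedHumbert Φ e η₀ η' ∧
      refinedHumbert Φ e η₀ η' = -2 * (torusIntegral Φ e ((ofRealForm η').wedge (ofRealForm η'))).re := by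
  obtain ⟨a, ha⟩ := hη.exists_int_re_torusIntegral_wedge Φ e hp.isRiemannForm.isNSForm
  have h2a : 2 ∣ a := (hη.two_dvd_refinedHumbert_iff Φ e hq ha).1 h2
  obtain ⟨η', hη', horth, hdec⟩ := hp.exists_eq_zsmul_add_orthogonal Φ e hη ha h2a
  refine ⟨a / 2, η', hη', horth, hdec, ?_, refinedHumbert_eq_neg_two_mul_of_orthogonal Φ e horth⟩
  rw [hdec, add_comm, refinedHumbert_add_zsmul Φ e (hp.re_torusIntegral_wedge_self_eq_two Φ e)]

/-- **Lemma 12, the sign: `q_A` is NEGATIVE definite on `ℤθ^⊥`** — for a non-zero `θ`-orthogonal `D′ ∈ NS(X)`,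
`(D′·D′) < 0`, so `q̃_θ(D′) = −2(D′·D′) > 0` (the Hodge index theorem, §2
`IsRiemannForm.re_torusIntegral_wedge_self_neg_of_orthogonal`). [cite: KaniCurvesGenus2AbelianSurfaces, §2 Lemma 12 (proof: "negative definite on `ℤθ^⊥` by the Hodge index theorem") (chunk p0008)] [cite: Hartshorne1977, Ch. V Thm. 1.9] -/
theorem IsPrincipalPolarization.refinedHumbert_pos_of_orthogonal [FiniteDimensional ℂ E] {η₀ : E [⋀^Fin 2]→L[ℝ] ℝ}
    (hp : IsPrincipalPolarization Φ η₀) {η' : E [⋀^Fin 2]→L[ℝ] ℝ} (hη' : IsNSForm Φ η') (hne : η' ≠ 0)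
    (horth : (torusIntegral Φ e ((ofRealForm η').wedge (ofRealForm η₀))).re = 0) :
    0 < refinedHumbert Φ e η₀ η' := by
  refine hp.refinedHumbert_pos_of_forall_ne Φ e hη' fun m hm ↦ ?_
  rw [hm, hp.re_torusIntegral_zsmul_wedge_self_eq_zero_iff Φ e] at horth
  rw [horth, zero_smul] at hm
  exact hne hm

end LemmaTwelve

end ComplexTorus

end Literature.Geometry.Kaehler

end
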